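import Summits.QuantumFields.YangMills.Theorems.UnitScaleTiltHalvingP1FlatCoreTopRowsReal
import Summits.QuantumFields.YangMills.Theorems.UnitScaleTiltHalvingP1FlatCoreTopRowsTrace
import Summits.QuantumFields.YangMills.Theorems.UnitScaleTiltHalvingP1FlatCoreTopStairs
import Summits.QuantumFields.YangMills.Theorems.UnitScaleTiltHalvingP1FlatCoreTopTargetTraceReads
import Summits.QuantumFields.YangMills.Theorems.UnitScaleTiltHalvingP1FlatCoreDP1Target
import Summits.QuantumFields.YangMills.Theorems.UnitScaleTiltProp8ChartDoubleBarBall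
import HarnessLib

/-!
# Line H (`BirthV10.stub_halvingStep`, stmt-QuantumFields-19200), LEAD-H (K-0) row **(K-DE): THE TORUS BLOCKS (D) AND (E) OF THE TOP-STEP CALL
# ✓`HalvingP1FlatCoreSupplierTopCall.topRows_of_datum(_traceFree)` DISCHARGED FROM READ-TERRITORY DATA** — the target `th hth hthk hthlo ‖th‖ hthτ haxT` and the
# four top rows `hTop121 hTop125 hTopReal hTopTrace` of ✓`P1FlatCoreTopStepTorus.hFP_kLevel_top_RD(_traceFree)` for a fine torus field `W₁` that is near `1`,
# unitary and of determinant one ONLY ON THE FINE BONDS WHOSE `k`-BLOCKS LIE IN A SET `T` OF TOP SITES (the member's top cube), with EXPLICIT constants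

Cell `ym3-torus` (HUMAN RULING D-0037: YM₃ on T³ is ladder rung R3, NOT the Clay problem), width seat `ym-ust-19936-w8` gen 3 (LEAD-H ★w5-19200 g5 (K-0) «w8-19936: (K-DE)»).
`--supports stmt-QuantumFields-19200 --as helper`; THEOREMS ONLY (0 `def`, 0 `sorry`); count-neutral; nothing here claims `core′`, `hSupU`, the stub, the crux or the gap.

LETTERS.  Fine torus `P`, top level `k ≤ m + K`, `W₁ : GaugeField P 0 M₂(ℂ)ˣ` (the member's `(U♯)^g`), a set `T` of `k`-sites with the READ-TERRITORY rows
`hW₁ : ‖W₁(b) − 1‖ ≤ s₀`, `hWu : W₁(b) ∈ U(2)`, `hdet : det W₁(b) = 1` for the fine bonds `b` whose two `k`-blocks lie in `T`, the ONE budget `8·3800·((d+2)L)²·Lᵏ·s₀ ≤ 1`;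
top labels `Λ ⊆ ℤᵈ` with `π_k yc ∈ T` (`hΛT`), base point `y₀`, the combs `Γ_{y₀, π_k yc}` inside `T` (`hcomb`, for the member ✓`P1FlatCoreTopCubeWalks.walk_treeWord_subset_Om_top`)
of length `≤ m₀` (`hlen`); the constants `δ := 8·(d+2)L·Lᵏ·s₀` (stairs, ✓`P1FlatCoreTopStairs`), `ω := d·L·α₄∕2` (oscillation), `τ₀ := 16·m₀·Lᵏ·s₀` (target).
WHAT.
* §1 `hsmall_of_reads` — `‖v₀(W̿₁^{(k)}; y₀, π_k yc) − 1‖ ≤ 8·m₀·Lᵏ·s₀` (✓`Prop8ChartDoubleBar.norm_dbarIterU_sub_one_le_two_mul₀` on the comb bonds ∘ ✓`P1FlatCoreDP1Target.norm_axialT_sub_one_le`);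
  `haxT_of_reads` — the `haxT` binder.
* §2 (D) ★★ `topTarget_of_reads` — `∃ th`, skew, `th (k, yc) = log v₀(…)` on `Λ`, `0` below the top, `‖th‖ ≤ τ₀`, `tr (th p) = 0` (✓`exists_topTarget_of_axialT_traceFree_of_reads`
  at `S := T`, `τ := τ₀`, window `24·m₀·Lᵏ·s₀ ≤ 1`).
* §3 (E) ★★ `hTop121_of_reads` (`Cb := 640(α₄ + δ + 5ω)ω`), ★★ `hTop125_of_reads` (`Cl := 10240·dL·(α₄ + δ + 11ω)`, i.e. ✓`top125_of_local` at `r := ω`), ★★ `hTopReal_of_reads`,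
  ★★ `hTopTrace_of_reads` (`τ := trCLM (Fin 2)`) — EXACTLY the `hTop121 hTop125 hTopReal` binders of ✓p646092 (and the `hTopTrace` binder of ✓p646499) for ANY `κf` with F3's
  recursion∕bottom (`hs`∕`h0`, ✓`exists_effGaugeFun`), under the ONE window `160·(α₄ + δ + 11ω) ≤ ¼` (✓`top121∕top125∕topReal∕topTrace_of_local` ∘ ✓`hH∕hWu∕hWτ_top_of_reads`).
HONEST SCOPE.  By-name composition; the representative rows `rep∕hrep` are ✓`P1FlatCoreTopTargetRep.hrep_cubeLamS` at the member (not restated); the geometry `hΛT hcomb hlen` and the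
two numeric windows are the (K-site) composer's ∕ (N05-WINDOWS)' inputs.  Nothing of [Balaban1985RegularSpaces] Prop. 5 ∕ Sect. E is proved here.

References: T. Bałaban, CMP **99** (1985) 75–102 [Balaban1985RegularSpaces] (Sect. E (1.91)–(1.92) p.98, (1.111)–(1.125) pp.95–97, (1.17) p.78);
CMP **98** (1985) 17–51 [Balaban1985Averaging] ((8)–(9) pp.18–19, (23) p.21, p.24, (110) p.34, Prop. 4 (134)–(135) p.38); CMP **116** (1988) [Balaban1987RG1] ((0.9) p.253).
-/

set_option autoImplicit false

noncomputable section

open scoped BigOperators Matrix.Norms.L2Operator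
open NormedSpace

namespace Summit.QuantumFields.YangMills.Theorems.P1FlatCoreTopBlocksAtMember

open Literature.MathematicalPhysics.QuantumFieldTheory.Balaban1983to89
open T4Continuum BlockAveraging ExpMeanLog MatrixLog
open B14DomainGeom (Pt)
open Node00 (coverAt)
open B7Prop1Explicit (treeWord l1 e)
open B7Prop1Local (InBox)
open B8Ineq130 (tlo thi)
open B5Eq118OneStroke (iterBlockOf)
open B10Eq27TorusAxialLog (rel axialT holT gaugeActT)
open B15Eq112TorusCover (cover)
open LatticeFieldCalculus (siteAvgIter)
open Literature.MathematicalPhysics.QuantumLattice (blockMap)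
open B8Eq1117Concrete (XSpace)
open B8SpecialUnitaryTrace (trCLM trCLM_mul_comm)
open Summit.QuantumFields.YangMills.Theorems.Prop8ChartDoubleBar (dbarIterU vframeU norm_dbarIterU_sub_one_le_two_mul₀)
open Summit.QuantumFields.YangMills.Theorems.P1FlatCoreDP1Target (norm_axialT_sub_one_le)
open Summit.QuantumFields.YangMills.Theorems.P1FlatCoreTopTargetRep (exists_topTarget_of_axialT_traceFree_of_reads)
open Summit.QuantumFields.YangMills.Theorems.P1FlatCoreTopStairs (hH_top_of_reads hWu_top_of_reads hWτ_top_of_reads)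
open Summit.QuantumFields.YangMills.Theorems.P1FlatCoreTopRowsLocal (top121_of_local top125_of_local topReal_of_local topTrace_of_local)

variable {P : Params}

/-! ## §1 The axial transporters of the double-bar top average on the combs inside `T` -/

section Axial

/-- **THE (o) DATUM IS SMALL ON THE READ TERRITORY**: if `W₁` is within `s₀` of `1` on the fine bonds whose `k`-blocks lie in `T` (`8·3800·((d+2)L)²·Lᵏ·s₀ ≤ 1`), the comb
`Γ_{y₀,x}` has all bond ends in `T`, length `≤ m₀` (`1 ≤ m₀`) and `32·m₀·Lᵏ·s₀ ≤ 1`, then `‖v₀(W̿₁^{(k)}; y₀, x) − 1‖ ≤ 8·m₀·Lᵏ·s₀` (each comb bond carries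
`‖U̿^{(k)}(c) − 1‖ ≤ 2Lᵏs₀`, ✓`norm_dbarIterU_sub_one_le_two_mul₀`; then ✓`norm_axialT_sub_one_le`). [cite: Balaban1985Averaging, p.24, (122)-(123) p.36; Balaban1987RG1, (0.9) p.253] -/
theorem hsmall_of_reads {k : ℕ} (hk : k ≤ P.m + P.K) (T : Set (Site P k)) (W₁ : GaugeField P 0 (Matrix (Fin 2) (Fin 2) ℂ)ˣ)
    {s₀ : ℝ} (hs₀ : 0 ≤ s₀) (hbudget : 8 * 3800 * (((P.d + 2) * P.L : ℕ) : ℝ) ^ 2 * (P.L : ℝ) ^ k * s₀ ≤ 1)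
    (hW₁ : ∀ b : PBond P 0, iterBlockOf k b.src ∈ T → iterBlockOf k b.tgt ∈ T →
      ‖((W₁ b : (Matrix (Fin 2) (Fin 2) ℂ)ˣ) : Matrix (Fin 2) (Fin 2) ℂ) - 1‖ ≤ s₀)
    (y₀ x : Site P k) (hcomb : ∀ st ∈ walk y₀ (treeWord (rel y₀ x)), st.bond.src ∈ T ∧ st.bond.tgt ∈ T)
    {m₀ : ℕ} (hm₀ : 1 ≤ m₀) (hlen : l1 (rel y₀ x) ≤ m₀) (hm : 32 * (m₀ : ℝ) * ((P.L : ℝ) ^ k * s₀) ≤ 1) :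
    ‖((axialT (dbarIterU k W₁) y₀ x : (Matrix (Fin 2) (Fin 2) ℂ)ˣ) : Matrix (Fin 2) (Fin 2) ℂ) - 1‖ ≤ 8 * (m₀ : ℝ) * ((P.L : ℝ) ^ k * s₀) := by
  have hx0 : 0 ≤ (P.L : ℝ) ^ k * s₀ := by positivity
  have h := norm_axialT_sub_one_le (dbarIterU k W₁) y₀ x (show (0 : ℝ) ≤ 2 * ((P.L : ℝ) ^ k * s₀) by positivity) hm₀ (by linarith) hlen
    fun st hst => norm_dbarIterU_sub_one_le_two_mul₀ hk T W₁ hs₀ hbudget hW₁ st.bond (hcomb st hst).1 (hcomb st hst).2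
  linarith

/-- ★ **`haxT` OF ✓`hFP_kLevel_top_RD` FROM THE READ TERRITORY**: under §1's hypotheses for every `yc ∈ Λ` (combs `Γ_{y₀,π_k yc}` in `T`), `‖v₀(W̿₁^{(k)}; y₀, π_k yc) − 1‖ < 1`.
[cite: Balaban1985RegularSpaces, Sect. E (1.91) p.98; Balaban1985Averaging, p.24] -/
theorem haxT_of_reads {k : ℕ} (hk : k ≤ P.m + P.K) (T : Set (Site P k)) (W₁ : GaugeField P 0 (Matrix (Fin 2) (Fin 2) ℂ)ˣ)
    {s₀ : ℝ} (hs₀ : 0 ≤ s₀) (hbudget : 8 * 3800 * (((P.d + 2) * P.L : ℕ) : ℝ) ^ 2 * (P.L : ℝ) ^ k * s₀ ≤ 1)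
    (hW₁ : ∀ b : PBond P 0, iterBlockOf k b.src ∈ T → iterBlockOf k b.tgt ∈ T →
      ‖((W₁ b : (Matrix (Fin 2) (Fin 2) ℂ)ˣ) : Matrix (Fin 2) (Fin 2) ℂ) - 1‖ ≤ s₀)
    (y₀ : Site P k) (Λ : Set (Pt P.d))
    (hcomb : ∀ yc ∈ Λ, ∀ st ∈ walk y₀ (treeWord (rel y₀ (coverAt P k yc))), st.bond.src ∈ T ∧ st.bond.tgt ∈ T)
    {m₀ : ℕ} (hm₀ : 1 ≤ m₀) (hlen : ∀ yc ∈ Λ, l1 (rel y₀ (coverAt P k yc)) ≤ m₀) (hm : 32 * (m₀ : ℝ) * ((P.L : ℝ) ^ k * s₀) ≤ 1) :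
    ∀ yc ∈ Λ, ‖((axialT (dbarIterU k W₁) y₀ (coverAt P k yc) : (Matrix (Fin 2) (Fin 2) ℂ)ˣ) : Matrix (Fin 2) (Fin 2) ℂ) - 1‖ < 1 := by
  intro yc hyc
  have h := hsmall_of_reads hk T W₁ hs₀ hbudget hW₁ y₀ (coverAt P k yc) (hcomb yc hyc) hm₀ (hlen yc hyc) hm
  have hx0 : 0 ≤ (P.L : ℝ) ^ k * s₀ := by positivity
  linarith

end Axial

/-! ## §2 Block (D): the target of the top step from read-territory data -/

section Target

/-- ★★ **BLOCK (D): THE TARGET `th` WITH ITS FIVE ROWS** (`hth`, `hthk`, `hthlo`, `‖th‖ ≤ τ₀ := 16·m₀·Lᵏ·s₀`, `hthτ` at `τ := tr`) for a field near `1`, unitary and of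
determinant one on the fine bonds whose `k`-blocks lie in `T`, the combs `Γ_{y₀,π_k yc}` (`yc ∈ Λ`) inside `T` of length `≤ m₀`, `24·m₀·Lᵏ·s₀ ≤ 1` and `32·m₀·Lᵏ·s₀ ≤ 1`
(✓`exists_topTarget_of_axialT_traceFree_of_reads` at `S := T`, `τ := τ₀`, with `hsmall` from §1). [cite: Balaban1985RegularSpaces, Sect. E (1.91)-(1.92) p.98, (1.17) p.78; Balaban1985Averaging, (23) p.21, p.24] -/
theorem topTarget_of_reads {k : ℕ} (hk : k ≤ P.m + P.K) (T : Set (Site P k)) (W₁ : GaugeField P 0 (Matrix (Fin 2) (Fin 2) ℂ)ˣ)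
    {s₀ : ℝ} (hs₀ : 0 ≤ s₀) (hbudget : 8 * 3800 * (((P.d + 2) * P.L : ℕ) : ℝ) ^ 2 * (P.L : ℝ) ^ k * s₀ ≤ 1)
    (hW₁ : ∀ b : PBond P 0, iterBlockOf k b.src ∈ T → iterBlockOf k b.tgt ∈ T →
      ‖((W₁ b : (Matrix (Fin 2) (Fin 2) ℂ)ˣ) : Matrix (Fin 2) (Fin 2) ℂ) - 1‖ ≤ s₀)
    (hWu : ∀ b : PBond P 0, iterBlockOf k b.src ∈ T → iterBlockOf k b.tgt ∈ T →
      ((W₁ b : (Matrix (Fin 2) (Fin 2) ℂ)ˣ) : Matrix (Fin 2) (Fin 2) ℂ) ∈ Matrix.unitaryGroup (Fin 2) ℂ)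
    (hdet : ∀ b : PBond P 0, iterBlockOf k b.src ∈ T → iterBlockOf k b.tgt ∈ T →
      ((W₁ b : (Matrix (Fin 2) (Fin 2) ℂ)ˣ) : Matrix (Fin 2) (Fin 2) ℂ).det = 1)
    (y₀ : Site P k) (Λ : Set (Pt P.d))
    (hcomb : ∀ yc ∈ Λ, ∀ st ∈ walk y₀ (treeWord (rel y₀ (coverAt P k yc))), st.bond.src ∈ T ∧ st.bond.tgt ∈ T)
    {m₀ : ℕ} (hm₀ : 1 ≤ m₀) (hlen : ∀ yc ∈ Λ, l1 (rel y₀ (coverAt P k yc)) ≤ m₀) (hm : 32 * (m₀ : ℝ) * ((P.L : ℝ) ^ k * s₀) ≤ 1) :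
    ∃ th : XSpace P.d k (Matrix (Fin 2) (Fin 2) ℂ),
      (∀ p, star (th p) = -th p) ∧
      (∀ yc ∈ Λ, th (⟨k, Nat.lt_succ_self k⟩, yc) =
        mlog ((axialT (dbarIterU k W₁) y₀ (coverAt P k yc) : (Matrix (Fin 2) (Fin 2) ℂ)ˣ) : Matrix (Fin 2) (Fin 2) ℂ)) ∧
      (∀ (j : ℕ) (hj : j < k) (y : Pt P.d), th (⟨j, Nat.lt_succ_of_lt hj⟩, y) = 0) ∧
      ‖th‖ ≤ 16 * (m₀ : ℝ) * ((P.L : ℝ) ^ k * s₀) ∧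
      (∀ p, trCLM (Fin 2) (th p) = 0) := by
  have hx0 : 0 ≤ (P.L : ℝ) ^ k * s₀ := by positivity
  exact exists_topTarget_of_axialT_traceFree_of_reads hk T W₁ hs₀ hbudget hW₁ hWu hdet y₀ Λ hcomb (by positivity) (by linarith)
    fun yc hyc => (hsmall_of_reads hk T W₁ hs₀ hbudget hW₁ y₀ (coverAt P k yc) (hcomb yc hyc) hm₀ (hlen yc hyc) hm).trans (by linarith)

end Target

/-! ## §3 Block (E): the four top rows in torus letters, for a field controlled on the territories under the top labels -/

section Rows

variable [Nonempty (Idx P)]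

/-- ★★ **BLOCK (E), ROW (1.121)** — the `hTop121` binder of ✓`topRows_of_datum` with `Cb := 640·(α₄ + δ + 5ω)·ω`, `δ := 8·(d+2)L·Lᵏ·s₀`, `ω := d·L·α₄∕2`, for ANY
effective-gauge tower `κf` with F3's recursion∕bottom, from `W₁` within `s₀` of `1` on the territories of the top labels (`π_k yc ∈ T`) and the window
`160·(α₄ + δ + 11ω) ≤ ¼` (✓`top121_of_local` ∘ ✓`hH_top_of_reads`). [cite: Balaban1985RegularSpaces, Sect. E (1.120)-(1.121) pp.95-96; Balaban1985Averaging, (110) p.34, Prop. 4 (134)-(135) p.38] -/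
theorem hTop121_of_reads {k : ℕ} (hk : k ≤ P.m + P.K) (T : Set (Site P k)) (W₁ : GaugeField P 0 (Matrix (Fin 2) (Fin 2) ℂ)ˣ)
    {s₀ : ℝ} (hs₀ : 0 ≤ s₀) (hbudget : 8 * 3800 * (((P.d + 2) * P.L : ℕ) : ℝ) ^ 2 * (P.L : ℝ) ^ k * s₀ ≤ 1)
    (hW₁ : ∀ b : PBond P 0, iterBlockOf k b.src ∈ T → iterBlockOf k b.tgt ∈ T →
      ‖((W₁ b : (Matrix (Fin 2) (Fin 2) ℂ)ˣ) : Matrix (Fin 2) (Fin 2) ℂ) - 1‖ ≤ s₀)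
    (κf : (Site P 0 → Matrix (Fin 2) (Fin 2) ℂ) → (i : ℕ) → GaugeTransf P i (Matrix (Fin 2) (Fin 2) ℂ)ˣ)
    (hs : ∀ (m : Site P 0 → Matrix (Fin 2) (Fin 2) ℂ) (i : ℕ) (y : Site P (i + 1)),
      κf m (i + 1) y = (vframeU (gaugeActT (κf m i) (dbarIterU i W₁)) y)⁻¹ * κf m i (emb y) * vframeU (dbarIterU i W₁) y)
    (h0 : ∀ (m : Site P 0 → Matrix (Fin 2) (Fin 2) ℂ) (x : Site P 0), ((κf m 0 x : (Matrix (Fin 2) (Fin 2) ℂ)ˣ) : Matrix (Fin 2) (Fin 2) ℂ) = exp (m x))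
    (Λ : Set (Pt P.d)) (hΛT : ∀ yc ∈ Λ, coverAt P k yc ∈ T) {α₄ : ℝ} (hα₄ : 0 ≤ α₄)
    (hr : 160 * (α₄ + 8 * (((P.d + 2) * P.L : ℕ) : ℝ) * (P.L : ℝ) ^ k * s₀ + 11 * ((P.d : ℝ) * P.L * α₄ / 2)) ≤ 1 / 4) :
    ∀ yc ∈ Λ, ∀ l₀ : Site P 0 → Matrix (Fin 2) (Fin 2) ℂ,
      (∀ x : Pt P.d, InBox (tlo P.L yc k) (thi P.L yc k) x → ‖l₀ (cover P x)‖ ≤ α₄) →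
      (∀ (x : Pt P.d) (κ : Fin P.d), InBox (tlo P.L yc k) (thi P.L yc k) x → InBox (tlo P.L yc k) (thi P.L yc k) (x + e κ) →
        ‖l₀ (cover P (x + e κ)) - l₀ (cover P x)‖ ≤ α₄ * ((P.L : ℝ) ^ k)⁻¹) →
      exp (mlog ((κf l₀ k (coverAt P k yc) : (Matrix (Fin 2) (Fin 2) ℂ)ˣ) : Matrix (Fin 2) (Fin 2) ℂ)) =
          ((κf l₀ k (coverAt P k yc) : (Matrix (Fin 2) (Fin 2) ℂ)ˣ) : Matrix (Fin 2) (Fin 2) ℂ) ∧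
        ‖mlog ((κf l₀ k (coverAt P k yc) : (Matrix (Fin 2) (Fin 2) ℂ)ˣ) : Matrix (Fin 2) (Fin 2) ℂ) - siteAvgIter k l₀ (coverAt P k yc)‖ ≤
          640 * (α₄ + 8 * (((P.d + 2) * P.L : ℕ) : ℝ) * (P.L : ℝ) ^ k * s₀ + 5 * ((P.d : ℝ) * P.L * α₄ / 2)) * ((P.d : ℝ) * P.L * α₄ / 2) := by
  intro yc hyc l₀ hb hg
  have hω0 : 0 ≤ (P.d : ℝ) * P.L * α₄ / 2 := by positivity
  have hδ0 : 0 ≤ 8 * (((P.d + 2) * P.L : ℕ) : ℝ) * (P.L : ℝ) ^ k * s₀ := by positivity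
  have hU : ∀ b : PBond P 0, iterBlockOf k b.src = coverAt P k yc → iterBlockOf k b.tgt = coverAt P k yc →
      ‖((W₁ b : (Matrix (Fin 2) (Fin 2) ℂ)ˣ) : Matrix (Fin 2) (Fin 2) ℂ) - 1‖ ≤ s₀ :=
    fun b hs' ht' => hW₁ b (hs' ▸ hΛT yc hyc) (ht' ▸ hΛT yc hyc)
  exact top121_of_local hk W₁ (κf l₀) (hs l₀) l₀ (h0 l₀) hα₄ hδ0 yc (hH_top_of_reads hk yc W₁ hs₀ hbudget hU) (by linarith) hb hg

/-- ★★ **BLOCK (E), ROW (1.125)** — the `hTop125` binder of ✓`topRows_of_datum` with `Cl := 10240·dL·(α₄ + δ + 11ω)` (✓`top125_of_local` at the free radius `r := ω = d·L·α₄∕2`,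
`0 < α₄`), same territory hypotheses and window as `hTop121_of_reads`. [cite: Balaban1985RegularSpaces, Sect. E (1.124)-(1.125) pp.96-97; Balaban1985Averaging, (110) p.34, Prop. 4 (134)-(135) p.38] -/
theorem hTop125_of_reads {k : ℕ} (hk : k ≤ P.m + P.K) (T : Set (Site P k)) (W₁ : GaugeField P 0 (Matrix (Fin 2) (Fin 2) ℂ)ˣ)
    {s₀ : ℝ} (hs₀ : 0 ≤ s₀) (hbudget : 8 * 3800 * (((P.d + 2) * P.L : ℕ) : ℝ) ^ 2 * (P.L : ℝ) ^ k * s₀ ≤ 1)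
    (hW₁ : ∀ b : PBond P 0, iterBlockOf k b.src ∈ T → iterBlockOf k b.tgt ∈ T →
      ‖((W₁ b : (Matrix (Fin 2) (Fin 2) ℂ)ˣ) : Matrix (Fin 2) (Fin 2) ℂ) - 1‖ ≤ s₀)
    (κf : (Site P 0 → Matrix (Fin 2) (Fin 2) ℂ) → (i : ℕ) → GaugeTransf P i (Matrix (Fin 2) (Fin 2) ℂ)ˣ)
    (hs : ∀ (m : Site P 0 → Matrix (Fin 2) (Fin 2) ℂ) (i : ℕ) (y : Site P (i + 1)),
      κf m (i + 1) y = (vframeU (gaugeActT (κf m i) (dbarIterU i W₁)) y)⁻¹ * κf m i (emb y) * vframeU (dbarIterU i W₁) y)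
    (h0 : ∀ (m : Site P 0 → Matrix (Fin 2) (Fin 2) ℂ) (x : Site P 0), ((κf m 0 x : (Matrix (Fin 2) (Fin 2) ℂ)ˣ) : Matrix (Fin 2) (Fin 2) ℂ) = exp (m x))
    (Λ : Set (Pt P.d)) (hΛT : ∀ yc ∈ Λ, coverAt P k yc ∈ T) {α₄ : ℝ} (hα₄ : 0 < α₄)
    (hr : 160 * (α₄ + 8 * (((P.d + 2) * P.L : ℕ) : ℝ) * (P.L : ℝ) ^ k * s₀ + 11 * ((P.d : ℝ) * P.L * α₄ / 2)) ≤ 1 / 4) :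
    ∀ yc ∈ Λ, ∀ (l₁ l₂ : Site P 0 → Matrix (Fin 2) (Fin 2) ℂ) (r : ℝ), 0 ≤ r →
      (∀ x : Pt P.d, InBox (tlo P.L yc k) (thi P.L yc k) x → ‖l₁ (cover P x)‖ ≤ α₄) →
      (∀ (x : Pt P.d) (κ : Fin P.d), InBox (tlo P.L yc k) (thi P.L yc k) x → InBox (tlo P.L yc k) (thi P.L yc k) (x + e κ) →
        ‖l₁ (cover P (x + e κ)) - l₁ (cover P x)‖ ≤ α₄ * ((P.L : ℝ) ^ k)⁻¹) →
      (∀ x : Pt P.d, InBox (tlo P.L yc k) (thi P.L yc k) x → ‖l₂ (cover P x)‖ ≤ α₄) →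
      (∀ (x : Pt P.d) (κ : Fin P.d), InBox (tlo P.L yc k) (thi P.L yc k) x → InBox (tlo P.L yc k) (thi P.L yc k) (x + e κ) →
        ‖l₂ (cover P (x + e κ)) - l₂ (cover P x)‖ ≤ α₄ * ((P.L : ℝ) ^ k)⁻¹) →
      (∀ x : Pt P.d, InBox (tlo P.L yc k) (thi P.L yc k) x → ‖l₁ (cover P x) - l₂ (cover P x)‖ ≤ r) →
      (∀ (x : Pt P.d) (κ : Fin P.d), InBox (tlo P.L yc k) (thi P.L yc k) x → InBox (tlo P.L yc k) (thi P.L yc k) (x + e κ) →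
        ‖(l₁ (cover P (x + e κ)) - l₂ (cover P (x + e κ))) - (l₁ (cover P x) - l₂ (cover P x))‖ ≤ r * ((P.L : ℝ) ^ k)⁻¹) →
      ‖(mlog ((κf l₁ k (coverAt P k yc) : (Matrix (Fin 2) (Fin 2) ℂ)ˣ) : Matrix (Fin 2) (Fin 2) ℂ) - siteAvgIter k l₁ (coverAt P k yc)) -
          (mlog ((κf l₂ k (coverAt P k yc) : (Matrix (Fin 2) (Fin 2) ℂ)ˣ) : Matrix (Fin 2) (Fin 2) ℂ) - siteAvgIter k l₂ (coverAt P k yc))‖ ≤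
        (10240 * ((P.d : ℝ) * P.L) * (α₄ + 8 * (((P.d + 2) * P.L : ℕ) : ℝ) * (P.L : ℝ) ^ k * s₀ + 11 * ((P.d : ℝ) * P.L * α₄ / 2))) * r := by
  intro yc hyc l₁ l₂ r hr0 h1b h1g h2b h2g hmb hmg
  set ω : ℝ := (P.d : ℝ) * P.L * α₄ / 2 with hω
  set δ : ℝ := 8 * (((P.d + 2) * P.L : ℕ) : ℝ) * (P.L : ℝ) ^ k * s₀ with hδ
  have hd1 : (1 : ℝ) ≤ P.d := by exact_mod_cast P.hd
  have hL1 : (1 : ℝ) ≤ P.L := by exact_mod_cast P.L_pos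
  have hdpos : (0 : ℝ) < P.d := by linarith
  have hLpos : (0 : ℝ) < P.L := by linarith
  have hω0 : 0 < ω := by rw [hω]; positivity
  have hδ0 : 0 ≤ δ := by positivity
  have hU : ∀ b : PBond P 0, iterBlockOf k b.src = coverAt P k yc → iterBlockOf k b.tgt = coverAt P k yc →
      ‖((W₁ b : (Matrix (Fin 2) (Fin 2) ℂ)ˣ) : Matrix (Fin 2) (Fin 2) ℂ) - 1‖ ≤ s₀ :=
    fun b hs' ht' => hW₁ b (hs' ▸ hΛT yc hyc) (ht' ▸ hΛT yc hyc)
  have hr' : 160 * (α₄ + ω + δ + 5 * ((P.d : ℝ) * P.L * α₄ / 2 + ω)) ≤ 1 / 4 := by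
    have : α₄ + ω + δ + 5 * ((P.d : ℝ) * P.L * α₄ / 2 + ω) = α₄ + δ + 11 * ω := by rw [hω]; ring
    rw [this]; exact hr
  have h := top125_of_local hk W₁ κf hs h0 hα₄.le hδ0 hω0 yc (hH_top_of_reads hk yc W₁ hs₀ hbudget hU) hr' l₁ l₂ r hr0 h1b h1g h2b h2g hmb hmg
  have hC : 8 * (640 * (α₄ + ω + δ + 5 * ((P.d : ℝ) * P.L * α₄ / 2 + ω)) * ((P.d : ℝ) * P.L * α₄ / 2 + ω)) * ((P.d : ℝ) * P.L) / ω =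
      10240 * ((P.d : ℝ) * P.L) * (α₄ + δ + 11 * ω) := by
    rw [← hω]
    field_simp
    ring
  rw [hC] at h
  exact h

/-- ★★ **BLOCK (E), REALITY ROW** — the `hTopReal` binder of ✓`topRows_of_datum`, from `W₁` within `s₀` of `1` AND UNITARY on the territories of the top labels and the window
`160·(α₄ + δ + 11ω) ≤ ¼` (✓`topReal_of_local` ∘ ✓`hH_top_of_reads` ∘ ✓`hWu_top_of_reads`; its `δ ≤ 1∕12`, `2δ + 4(α₄ + ω) ≤ 1∕24` follow from the window).
[cite: Balaban1985RegularSpaces, Sect. E (1.111), (1.116) pp.95-96; Balaban1985Averaging, (21) p.21, (110) p.34] -/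
theorem hTopReal_of_reads {k : ℕ} (hk : k ≤ P.m + P.K) (T : Set (Site P k)) (W₁ : GaugeField P 0 (Matrix (Fin 2) (Fin 2) ℂ)ˣ)
    {s₀ : ℝ} (hs₀ : 0 ≤ s₀) (hbudget : 8 * 3800 * (((P.d + 2) * P.L : ℕ) : ℝ) ^ 2 * (P.L : ℝ) ^ k * s₀ ≤ 1)
    (hW₁ : ∀ b : PBond P 0, iterBlockOf k b.src ∈ T → iterBlockOf k b.tgt ∈ T →
      ‖((W₁ b : (Matrix (Fin 2) (Fin 2) ℂ)ˣ) : Matrix (Fin 2) (Fin 2) ℂ) - 1‖ ≤ s₀)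
    (hWu : ∀ b : PBond P 0, iterBlockOf k b.src ∈ T → iterBlockOf k b.tgt ∈ T →
      ((W₁ b : (Matrix (Fin 2) (Fin 2) ℂ)ˣ) : Matrix (Fin 2) (Fin 2) ℂ) ∈ Matrix.unitaryGroup (Fin 2) ℂ)
    (κf : (Site P 0 → Matrix (Fin 2) (Fin 2) ℂ) → (i : ℕ) → GaugeTransf P i (Matrix (Fin 2) (Fin 2) ℂ)ˣ)
    (hs : ∀ (m : Site P 0 → Matrix (Fin 2) (Fin 2) ℂ) (i : ℕ) (y : Site P (i + 1)),
      κf m (i + 1) y = (vframeU (gaugeActT (κf m i) (dbarIterU i W₁)) y)⁻¹ * κf m i (emb y) * vframeU (dbarIterU i W₁) y)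
    (h0 : ∀ (m : Site P 0 → Matrix (Fin 2) (Fin 2) ℂ) (x : Site P 0), ((κf m 0 x : (Matrix (Fin 2) (Fin 2) ℂ)ˣ) : Matrix (Fin 2) (Fin 2) ℂ) = exp (m x))
    (Λ : Set (Pt P.d)) (hΛT : ∀ yc ∈ Λ, coverAt P k yc ∈ T) {α₄ : ℝ} (hα₄ : 0 ≤ α₄)
    (hr : 160 * (α₄ + 8 * (((P.d + 2) * P.L : ℕ) : ℝ) * (P.L : ℝ) ^ k * s₀ + 11 * ((P.d : ℝ) * P.L * α₄ / 2)) ≤ 1 / 4) :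
    ∀ yc ∈ Λ, ∀ l₀ : Site P 0 → Matrix (Fin 2) (Fin 2) ℂ,
      (∀ x : Pt P.d, InBox (tlo P.L yc k) (thi P.L yc k) x → ‖l₀ (cover P x)‖ ≤ α₄) →
      (∀ (x : Pt P.d) (κ : Fin P.d), InBox (tlo P.L yc k) (thi P.L yc k) x → InBox (tlo P.L yc k) (thi P.L yc k) (x + e κ) →
        ‖l₀ (cover P (x + e κ)) - l₀ (cover P x)‖ ≤ α₄ * ((P.L : ℝ) ^ k)⁻¹) →
      mlog ((κf (fun s => -star (l₀ s)) k (coverAt P k yc) : (Matrix (Fin 2) (Fin 2) ℂ)ˣ) : Matrix (Fin 2) (Fin 2) ℂ) -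
          siteAvgIter k (fun s => -star (l₀ s)) (coverAt P k yc) =
        -star (mlog ((κf l₀ k (coverAt P k yc) : (Matrix (Fin 2) (Fin 2) ℂ)ˣ) : Matrix (Fin 2) (Fin 2) ℂ) - siteAvgIter k l₀ (coverAt P k yc)) := by
  intro yc hyc l₀ hb hg
  letI : CStarAlgebra (Matrix (Fin 2) (Fin 2) ℂ) := {}
  have hω0 : 0 ≤ (P.d : ℝ) * P.L * α₄ / 2 := by positivity
  have hδ0 : 0 ≤ 8 * (((P.d + 2) * P.L : ℕ) : ℝ) * (P.L : ℝ) ^ k * s₀ := by positivity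
  have hU : ∀ b : PBond P 0, iterBlockOf k b.src = coverAt P k yc → iterBlockOf k b.tgt = coverAt P k yc →
      ‖((W₁ b : (Matrix (Fin 2) (Fin 2) ℂ)ˣ) : Matrix (Fin 2) (Fin 2) ℂ) - 1‖ ≤ s₀ :=
    fun b hs' ht' => hW₁ b (hs' ▸ hΛT yc hyc) (ht' ▸ hΛT yc hyc)
  have hun : ∀ b : PBond P 0, iterBlockOf k b.src = coverAt P k yc → iterBlockOf k b.tgt = coverAt P k yc →
      ((W₁ b : (Matrix (Fin 2) (Fin 2) ℂ)ˣ) : Matrix (Fin 2) (Fin 2) ℂ) ∈ Matrix.unitaryGroup (Fin 2) ℂ :=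
    fun b hs' ht' => hWu b (hs' ▸ hΛT yc hyc) (ht' ▸ hΛT yc hyc)
  exact topReal_of_local hk W₁ κf hs h0 hα₄ hδ0 yc (hH_top_of_reads hk yc W₁ hs₀ hbudget hU) (hWu_top_of_reads hk yc W₁ hs₀ hbudget hU hun)
    (by linarith) (by linarith) (by linarith) l₀ hb hg

/-- ★★ **BLOCK (E), TRACE ROW** (`τ := tr`) — the `hTopTrace` binder of ✓`hFP_kLevel_top_RD_traceFree` ∕ ✓`topRows_of_datum_traceFree` at `τ := trCLM (Fin 2)`, from `W₁` within
`s₀` of `1` AND OF DETERMINANT ONE on the territories of the top labels and the window (✓`topTrace_of_local` ∘ ✓`hH_top_of_reads` ∘ ✓`hWτ_top_of_reads`; `hτ := trCLM_mul_comm`).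
[cite: Balaban1985RegularSpaces, p.76, (1.17) p.78, Sect. E (1.120)-(1.121) pp.95-96; Balaban1985Averaging, (110) p.34] -/
theorem hTopTrace_of_reads {k : ℕ} (hk : k ≤ P.m + P.K) (T : Set (Site P k)) (W₁ : GaugeField P 0 (Matrix (Fin 2) (Fin 2) ℂ)ˣ)
    {s₀ : ℝ} (hs₀ : 0 ≤ s₀) (hbudget : 8 * 3800 * (((P.d + 2) * P.L : ℕ) : ℝ) ^ 2 * (P.L : ℝ) ^ k * s₀ ≤ 1)
    (hW₁ : ∀ b : PBond P 0, iterBlockOf k b.src ∈ T → iterBlockOf k b.tgt ∈ T →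
      ‖((W₁ b : (Matrix (Fin 2) (Fin 2) ℂ)ˣ) : Matrix (Fin 2) (Fin 2) ℂ) - 1‖ ≤ s₀)
    (hdet : ∀ b : PBond P 0, iterBlockOf k b.src ∈ T → iterBlockOf k b.tgt ∈ T →
      ((W₁ b : (Matrix (Fin 2) (Fin 2) ℂ)ˣ) : Matrix (Fin 2) (Fin 2) ℂ).det = 1)
    (κf : (Site P 0 → Matrix (Fin 2) (Fin 2) ℂ) → (i : ℕ) → GaugeTransf P i (Matrix (Fin 2) (Fin 2) ℂ)ˣ)
    (hs : ∀ (m : Site P 0 → Matrix (Fin 2) (Fin 2) ℂ) (i : ℕ) (y : Site P (i + 1)),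
      κf m (i + 1) y = (vframeU (gaugeActT (κf m i) (dbarIterU i W₁)) y)⁻¹ * κf m i (emb y) * vframeU (dbarIterU i W₁) y)
    (h0 : ∀ (m : Site P 0 → Matrix (Fin 2) (Fin 2) ℂ) (x : Site P 0), ((κf m 0 x : (Matrix (Fin 2) (Fin 2) ℂ)ˣ) : Matrix (Fin 2) (Fin 2) ℂ) = exp (m x))
    (Λ : Set (Pt P.d)) (hΛT : ∀ yc ∈ Λ, coverAt P k yc ∈ T) {α₄ : ℝ} (hα₄ : 0 ≤ α₄)
    (hr : 160 * (α₄ + 8 * (((P.d + 2) * P.L : ℕ) : ℝ) * (P.L : ℝ) ^ k * s₀ + 11 * ((P.d : ℝ) * P.L * α₄ / 2)) ≤ 1 / 4) :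
    ∀ yc ∈ Λ, ∀ l₀ : Site P 0 → Matrix (Fin 2) (Fin 2) ℂ, (∀ s, trCLM (Fin 2) (l₀ s) = 0) →
      (∀ x : Pt P.d, InBox (tlo P.L yc k) (thi P.L yc k) x → ‖l₀ (cover P x)‖ ≤ α₄) →
      (∀ (x : Pt P.d) (κ : Fin P.d), InBox (tlo P.L yc k) (thi P.L yc k) x → InBox (tlo P.L yc k) (thi P.L yc k) (x + e κ) →
        ‖l₀ (cover P (x + e κ)) - l₀ (cover P x)‖ ≤ α₄ * ((P.L : ℝ) ^ k)⁻¹) →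
      trCLM (Fin 2) (mlog ((κf l₀ k (coverAt P k yc) : (Matrix (Fin 2) (Fin 2) ℂ)ˣ) : Matrix (Fin 2) (Fin 2) ℂ) - siteAvgIter k l₀ (coverAt P k yc)) = 0 := by
  intro yc hyc l₀ hl₀τ hb hg
  letI : CStarAlgebra (Matrix (Fin 2) (Fin 2) ℂ) := {}
  have hω0 : 0 ≤ (P.d : ℝ) * P.L * α₄ / 2 := by positivity
  have hδ0 : 0 ≤ 8 * (((P.d + 2) * P.L : ℕ) : ℝ) * (P.L : ℝ) ^ k * s₀ := by positivity
  have hU : ∀ b : PBond P 0, iterBlockOf k b.src = coverAt P k yc → iterBlockOf k b.tgt = coverAt P k yc →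
      ‖((W₁ b : (Matrix (Fin 2) (Fin 2) ℂ)ˣ) : Matrix (Fin 2) (Fin 2) ℂ) - 1‖ ≤ s₀ :=
    fun b hs' ht' => hW₁ b (hs' ▸ hΛT yc hyc) (ht' ▸ hΛT yc hyc)
  have hdt : ∀ b : PBond P 0, iterBlockOf k b.src = coverAt P k yc → iterBlockOf k b.tgt = coverAt P k yc →
      ((W₁ b : (Matrix (Fin 2) (Fin 2) ℂ)ˣ) : Matrix (Fin 2) (Fin 2) ℂ).det = 1 :=
    fun b hs' ht' => hdet b (hs' ▸ hΛT yc hyc) (ht' ▸ hΛT yc hyc)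
  exact topTrace_of_local hk W₁ κf hs h0 hα₄ hδ0 yc (hH_top_of_reads hk yc W₁ hs₀ hbudget hU) (trCLM (Fin 2)) (fun x y => trCLM_mul_comm x y)
    (hWτ_top_of_reads hk yc W₁ hs₀ hbudget hU hdt) (by linarith) l₀ hl₀τ hb hg

end Rows

end Summit.QuantumFields.YangMills.Theorems.P1FlatCoreTopBlocksAtMember

end
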